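import Mathlib
import Summits.Ventures.PercRepro2.ZMeanProof
import Summits.Ventures.PercRepro2.PendantRoot
import Summits.Ventures.PercRepro2.HMFLeaf
import Summits.Ventures.PercRepro2.HMFLeafStep

/-!
# An unmarked leaf is invisible to the mean field (blind cell PercRepro2, night-1 g7;
NIGHT1-POCKET.md «Lean status» — reduction (R1) of NIGHT1-G5 §9 (1) / MINE-A §25 in the kernel)

Let `x` be a vertex carrying exactly one edge `f = {x, y}`, with `x` none of the marks
`o, a₁, a₂, a₃, b`.  Then every mass of `HMFc` is free of the weight of `f`:
the marked connection events never use a leaf edge (`free_connEvent`), and for the mean field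
`X̂ = E[termW(C(a₃))]` the observable `ω ↦ termW(C(a₃)(ω))` equals `ω ↦ termW(C(a₃)(ω[f ↦ false]))`
pointwise — the leaf joins the cluster without changing its residual term (`termW_insert_leaf`),
and the residual terms themselves are free of `f` (`termW_leaf_free`).  Hence
`HMFc (p[f ↦ t]) = HMFc p` for every `t` (`HMFc_update_leaf`).
-/

namespace Summit.Ventures.PercRepro2

open UnionCluster CovForm PendantRoot HMFLeafStep HMFPendantRoot

namespace HMFLeafInvisible

open scoped Classical

variable {V : Type*} {E : Type*} [Fintype E] [DecidableEq E] [Fintype V] [DecidableEq V]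
  {R : Type*} [Field R] [LinearOrder R] [IsStrictOrderedRing R]

variable (p : E → R) (ends : E → Sym2 V) {f : E} {x y : V}

section Sets

variable {ends}

omit [Fintype E] [DecidableEq E] [Fintype V] [DecidableEq V] in
/-- Restriction to equal edge sets gives equal configurations. -/
lemma restrict_congr {S T : Set E} [DecidablePred (· ∈ S)] [DecidablePred (· ∈ T)] (h : S = T)
    (ω : Config E) : restrict S ω = restrict T ω := by
  funext e
  simp only [restrict]
  subst h
  congr 1
  exact decide_eq_decide.mpr Iff.rfl

omit [Fintype E] [DecidableEq E] [Fintype V] in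
/-- Adding the leaf to a set containing its neighbour does not change the touched edges. -/
lemma touches_insert_leaf (hf : ends f = s(x, y)) (hleaf : ∀ e, x ∈ ends e → e = f) {W : Finset V}
    (hy : y ∈ W) : touches ends (↑(insert x W) : Set V) = touches ends (↑W : Set V) := by
  apply le_antisymm
  · rintro e ⟨z, hz, w, hzw⟩
    rw [Finset.coe_insert, Set.mem_insert_iff] at hz
    rcases hz with rfl | hz
    · have hef : e = f := hleaf e (by rw [hzw]; exact Sym2.mem_mk_left z w)
      subst hef
      exact mem_touches_of_ends hf (Or.inr (Finset.mem_coe.2 hy))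
    · exact ⟨z, hz, w, hzw⟩
  · exact touches_mono (by simp)

omit [Fintype E] [DecidableEq E] in
/-- The residual connection events ignore an added leaf. -/
lemma connDelEvent_insert_leaf (hf : ends f = s(x, y)) (hleaf : ∀ e, x ∈ ends e → e = f)
    {W : Finset V} (hy : y ∈ W) (u v : V) :
    connDelEvent ends (insert x W) u v = connDelEvent ends W u v := by
  ext ω
  simp only [mem_connDelEvent]
  rw [restrict_congr (congrArg compl (touches_insert_leaf hf hleaf hy)) ω]

omit [Fintype E] [DecidableEq E] in
/-- The residual disconnection ignores an added leaf. -/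
lemma delQ_insert_leaf (hf : ends f = s(x, y)) (hleaf : ∀ e, x ∈ ends e → e = f)
    {W : Finset V} (hy : y ∈ W) (a₁ a₂ : V) :
    delQ ends (insert x W) a₁ a₂ = delQ ends W a₁ a₂ := by
  simp only [delQ, connDelEvent_insert_leaf hf hleaf hy]

end Sets

section Terms

variable {ends}

omit [LinearOrder R] [IsStrictOrderedRing R] in
/-- **The leaf joins a cluster without changing its term**: `termW(W ∪ {x}) = termW(W)` when
`y ∈ W` and `x` is no mark. -/
lemma termW_insert_leaf (hf : ends f = s(x, y)) (hleaf : ∀ e, x ∈ ends e → e = f)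
    {W : Finset V} (hy : y ∈ W) {o a₁ a₂ b : V} (hxo : x ≠ o) (hx1 : x ≠ a₁) (hx2 : x ≠ a₂)
    (hxb : x ≠ b) :
    termW p ends o a₁ a₂ b (insert x W) = termW p ends o a₁ a₂ b W := by
  have m1 : a₁ ∈ insert x W ↔ a₁ ∈ W := by simp [Finset.mem_insert, hx1.symm]
  have m2 : a₂ ∈ insert x W ↔ a₂ ∈ W := by simp [Finset.mem_insert, hx2.symm]
  have mo : o ∈ insert x W ↔ o ∈ W := by simp [Finset.mem_insert, hxo.symm]
  have mb : b ∈ insert x W ↔ b ∈ W := by simp [Finset.mem_insert, hxb.symm]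
  simp only [termW, termT, termPD, delConnProb, delShareMass, m1, m2, mo, mb,
    connDelEvent_insert_leaf hf hleaf hy, delQ_insert_leaf hf hleaf hy]

omit [Fintype E] [DecidableEq E] in
/-- A residual connection among non-leaf vertices is free of the leaf edge. -/
lemma free_connDelEvent (hf : ends f = s(x, y)) (hleaf : ∀ e, x ∈ ends e → e = f) (hxy : x ≠ y)
    (W : Finset V) {u v : V} (hu : u ≠ x) (hv : v ≠ x) : Free f (connDelEvent ends W u v) := by
  intro ω ω' hagree
  have h : ∀ e, e ≠ f → restrict (touches ends (↑W : Set V))ᶜ ω e =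
      restrict (touches ends (↑W : Set V))ᶜ ω' e := fun e he => by
    simp only [restrict]
    rw [hagree e he]
  simp only [connDelEvent, Set.mem_setOf_eq]
  exact propext ⟨conn_of_conn_of_eq_off_leaf hf hleaf hxy h hu hv,
    conn_of_conn_of_eq_off_leaf hf hleaf hxy (fun e he => (h e he).symm) hu hv⟩

omit [LinearOrder R] [IsStrictOrderedRing R] in
/-- **The residual terms are free of the weight of an unmarked leaf edge.** -/
lemma termW_leaf_free (hf : ends f = s(x, y)) (hleaf : ∀ e, x ∈ ends e → e = f) (hxy : x ≠ y)
    {o a₁ a₂ b : V} (hxo : x ≠ o) (hx1 : x ≠ a₁) (hx2 : x ≠ a₂) (hxb : x ≠ b) (W : Finset V)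
    (t : R) : termW (Function.update p f t) ends o a₁ a₂ b W = termW p ends o a₁ a₂ b W := by
  have hc : ∀ u v : V, u ≠ x → v ≠ x →
      prob (Function.update p f t) (connDelEvent ends W u v) = prob p (connDelEvent ends W u v) :=
    fun u v hu hv => PendantEdm.prob_update_of_free p (free_connDelEvent hf hleaf hxy W hu hv) t
  have hQ : prob (Function.update p f t) (delQ ends W a₁ a₂) = prob p (delQ ends W a₁ a₂) :=
    PendantEdm.prob_update_of_free p (free_connDelEvent hf hleaf hxy W hx1.symm hx2.symm).compl t
  have hQc : ∀ u v : V, u ≠ x → v ≠ x →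
      prob (Function.update p f t) (delQ ends W a₁ a₂ ∩ connDelEvent ends W u v) =
        prob p (delQ ends W a₁ a₂ ∩ connDelEvent ends W u v) := fun u v hu hv =>
    PendantEdm.prob_update_of_free p
      ((free_connDelEvent hf hleaf hxy W hx1.symm hx2.symm).compl.inter
        (free_connDelEvent hf hleaf hxy W hu hv)) t
  simp only [termW, termT, termPD, delConnProb, delShareMass, hc _ _ hx1.symm hxo.symm,
    hc _ _ hx2.symm hxo.symm, hc _ _ hx1.symm hxb.symm, hc _ _ hx2.symm hxb.symm, hQ,
    hQc _ _ hx1.symm hxo.symm, hQc _ _ hx2.symm hxo.symm, hQc _ _ hx1.symm hxb.symm,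
    hQc _ _ hx2.symm hxb.symm]

end Terms

section Clusters

variable {ends}

omit [Fintype E] [Fintype V] [DecidableEq V] in
/-- For a vertex `v ≠ x`, connections to `a₃ ≠ x` do not see the leaf edge. -/
lemma conn_update_false_iff (hf : ends f = s(x, y)) (hleaf : ∀ e, x ∈ ends e → e = f) (hxy : x ≠ y)
    {a₃ v : V} (h3 : a₃ ≠ x) (hv : v ≠ x) (ω : Config E) :
    Conn ends (Function.update ω f false) a₃ v ↔ Conn ends ω a₃ v := by
  have h : ∀ e, e ≠ f → (Function.update ω f false) e = ω e := fun e he =>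
    Function.update_of_ne he _ _
  exact ⟨conn_of_conn_of_eq_off_leaf hf hleaf hxy h h3 hv,
    conn_of_conn_of_eq_off_leaf hf hleaf hxy (fun e he => (h e he).symm) h3 hv⟩

omit [Fintype E] [DecidableEq E] [Fintype V] [DecidableEq V] in
/-- A Boolean that is not `false` is `true`. -/
lemma bool_true_of_ne_false' {b : Bool} (h : ¬ b = false) : b = true := by
  cases b <;> simp_all

omit [Fintype E] [DecidableEq E] [Fintype V] [DecidableEq V] in
/-- `a₃ ↔ x` iff the leaf edge is open and `a₃ ↔ y`. -/
lemma conn_leaf_iff (hf : ends f = s(x, y)) (hleaf : ∀ e, x ∈ ends e → e = f) (hxy : x ≠ y)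
    {a₃ : V} (h3 : a₃ ≠ x) (ω : Config E) :
    Conn ends ω a₃ x ↔ (ω f = true ∧ Conn ends ω a₃ y) := by
  constructor
  · intro h
    have hx : x ∈ cluster ends ω a₃ := h
    by_cases hω : ω f = false
    · have hcl := cluster_leaf_of_closed (a₃ := x) (a₂ := y) hf hleaf hxy hω
      have : a₃ ∈ cluster ends ω x := conn_symm h
      rw [hcl] at this
      exact absurd (Set.mem_singleton_iff.1 this) h3
    · have hω' : ω f = true := bool_true_of_ne_false' hω
      exact ⟨hω', conn_trans h (conn_of_openAdj ⟨f, hω', hf⟩)⟩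
  · rintro ⟨hω, h⟩
    exact conn_trans h (conn_symm (conn_of_openAdj ⟨f, hω, hf⟩))

omit [Fintype E] [Fintype V] in
/-- **The cluster of `a₃` with the leaf edge closed**: `C(a₃)(ω) = C(a₃)(ω[f ↦ false]) ∪ {x}` if
`ω f = true` and `y ∈ C(a₃)(ω[f ↦ false])`, and `C(a₃)(ω) = C(a₃)(ω[f ↦ false])` otherwise. -/
lemma cluster_eq_update_false (hf : ends f = s(x, y)) (hleaf : ∀ e, x ∈ ends e → e = f) (hxy : x ≠ y)
    {a₃ : V} (h3 : a₃ ≠ x) (ω : Config E) :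
    cluster ends ω a₃ =
      if ω f = true ∧ y ∈ cluster ends (Function.update ω f false) a₃ then
        insert x (cluster ends (Function.update ω f false) a₃)
      else cluster ends (Function.update ω f false) a₃ := by
  have hy' : y ≠ x := Ne.symm hxy
  have hcy : Conn ends (Function.update ω f false) a₃ y ↔ Conn ends ω a₃ y :=
    conn_update_false_iff hf hleaf hxy h3 hy' ω
  have hxK : x ∉ cluster ends (Function.update ω f false) a₃ := by
    intro h
    have hcl := cluster_leaf_of_closed (a₃ := x) (a₂ := y) hf hleaf hxy
      (ω := Function.update ω f false) (by simp)
    have : a₃ ∈ cluster ends (Function.update ω f false) x := conn_symm h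
    rw [hcl] at this
    exact h3 (Set.mem_singleton_iff.1 this)
  ext v
  by_cases hv : v = x
  · subst hv
    constructor
    · intro h
      have hc := (conn_leaf_iff hf hleaf hxy h3 ω).1 h
      rw [if_pos ⟨hc.1, hcy.2 hc.2⟩]
      exact Set.mem_insert v _
    · intro h
      split_ifs at h with hc
      · exact (conn_leaf_iff hf hleaf hxy h3 ω).2 ⟨hc.1, hcy.1 hc.2⟩
      · exact absurd h hxK
  · have := conn_update_false_iff hf hleaf hxy h3 hv ω
    split_ifs with hc
    · simp only [Set.mem_insert_iff, hv, false_or]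
      exact this.symm
    · exact this.symm

end Clusters

section MeanField

variable {ends}

omit [LinearOrder R] [IsStrictOrderedRing R] in
/-- `X̂` as the expectation of the residual term of the revealed cluster. -/
lemma Xhat_eq_expect (o a₁ a₂ a₃ b : V) :
    Xhat p ends o a₁ a₂ a₃ b =
      expect p (fun ω => termW p ends o a₁ a₂ b (cluster ends ω a₃).toFinset) := by
  rw [Xhat_eq_sum]
  have h := sum_prob_clusterEvent_inter_mul p ends a₃ Set.univ
    (fun S : Set V => termW p ends o a₁ a₂ b S.toFinset)
  simp only [Set.inter_univ, Set.indicator_univ, Pi.one_apply, one_mul, Finset.toFinset_coe] at h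
  exact h

omit [LinearOrder R] [IsStrictOrderedRing R] in
/-- **Pointwise**: the residual term of `C(a₃)` is the residual term of `C(a₃)` with the leaf edge
closed. -/
lemma termW_cluster_update_false (hf : ends f = s(x, y)) (hleaf : ∀ e, x ∈ ends e → e = f)
    (hxy : x ≠ y) {o a₁ a₂ a₃ b : V} (hxo : x ≠ o) (hx1 : x ≠ a₁) (hx2 : x ≠ a₂) (hx3 : a₃ ≠ x)
    (hxb : x ≠ b) (ω : Config E) :
    termW p ends o a₁ a₂ b (cluster ends ω a₃).toFinset =
      termW p ends o a₁ a₂ b (cluster ends (Function.update ω f false) a₃).toFinset := by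
  rw [cluster_eq_update_false hf hleaf hxy hx3 ω]
  split_ifs with hc
  · rw [Set.toFinset_insert]
    exact termW_insert_leaf p hf hleaf (Set.mem_toFinset.2 hc.2) hxo hx1 hx2 hxb
  · rfl

omit [Fintype V] [DecidableEq V] [LinearOrder R] [IsStrictOrderedRing R] in
/-- An observable invariant under forcing `f` has the same expectation under every weight of `f`. -/
lemma expect_update_of_forced (G : Config E → R)
    (hG : ∀ ω : Config E, G (Function.update ω f false) = G ω ∧ G (Function.update ω f true) = G ω)
    (t : R) : expect (Function.update p f t) G = expect p G := by
  rw [expect_eq_pin (Function.update p f t) G f, Function.update_idem, Function.update_idem,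
    Function.update_self, expect_update_one, expect_update_zero]
  have h1 : expect p (fun ω => G (Function.update ω f true)) = expect p G :=
    Finset.sum_congr rfl fun ω _ => by simp only [(hG ω).2]
  have h0 : expect p (fun ω => G (Function.update ω f false)) = expect p G :=
    Finset.sum_congr rfl fun ω _ => by simp only [(hG ω).1]
  rw [h1, h0]
  ring

omit [LinearOrder R] [IsStrictOrderedRing R] in
/-- **The mean field is invariant in the weight of an unmarked leaf edge.** -/
theorem Xhat_update_leaf (hf : ends f = s(x, y)) (hleaf : ∀ e, x ∈ ends e → e = f) (hxy : x ≠ y)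
    {o a₁ a₂ a₃ b : V} (hxo : x ≠ o) (hx1 : x ≠ a₁) (hx2 : x ≠ a₂) (hx3 : a₃ ≠ x) (hxb : x ≠ b)
    (t : R) : Xhat (Function.update p f t) ends o a₁ a₂ a₃ b = Xhat p ends o a₁ a₂ a₃ b := by
  set G : Config E → R := fun ω =>
    termW p ends o a₁ a₂ b (cluster ends (Function.update ω f false) a₃).toFinset with hG
  have hGf : ∀ ω : Config E, G (Function.update ω f false) = G ω ∧ G (Function.update ω f true) = G ω := by
    intro ω
    constructor <;> simp only [hG, Function.update_idem]
  have e1 : ∀ q : E → R, termW q ends o a₁ a₂ b = termW p ends o a₁ a₂ b → Xhat q ends o a₁ a₂ a₃ b = expect q G := by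
    intro q hq
    rw [Xhat_eq_expect q o a₁ a₂ a₃ b]
    refine Finset.sum_congr rfl fun ω _ => ?_
    simp only [hq, hG, termW_cluster_update_false p hf hleaf hxy hxo hx1 hx2 hx3 hxb ω]
  rw [e1 (Function.update p f t) (funext fun W => termW_leaf_free p hf hleaf hxy hxo hx1 hx2 hxb W t),
    e1 p rfl, expect_update_of_forced p G hGf t]

end MeanField

section Main

variable {ends}

omit [Fintype E] [DecidableEq E] [Fintype V] [DecidableEq V] [LinearOrder R] [IsStrictOrderedRing R] in
/-- Unions of free events are free. -/
lemma free_union {A B : Set (Config E)} (hA : Free f A) (hB : Free f B) : Free f (A ∪ B) := by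
  have := dependsOn_union hA hB
  rwa [Set.union_self] at this

omit [LinearOrder R] [IsStrictOrderedRing R] in
/-- **An unmarked leaf is invisible to the mean-field functional**: `HMFc (p[f ↦ t]) = HMFc p` for
every weight `t` of the edge `f = {x, y}` of a leaf `x` that is none of the marks. -/
theorem HMFc_update_leaf (hf : ends f = s(x, y)) (hleaf : ∀ e, x ∈ ends e → e = f) (hxy : x ≠ y)
    {o a₁ a₂ a₃ b : V} (hxo : x ≠ o) (hx1 : x ≠ a₁) (hx2 : x ≠ a₂) (hx3 : x ≠ a₃) (hxb : x ≠ b)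
    (t : R) : HMFc (Function.update p f t) ends o a₁ a₂ a₃ b = HMFc p ends o a₁ a₂ a₃ b := by
  have hc : ∀ u v : V, u ≠ x → v ≠ x → Free f (connEvent ends u v) := fun u v hu hv =>
    free_connEvent hf hleaf hxy hu hv
  have hQ : Free f (avoidAll ends a₂ {a₁}) := by
    rw [avoidAll_eq_compl]; exact (hc a₁ a₂ hx1.symm hx2.symm).compl
  have hPD : Free f (PDEvent ends a₁ a₂ a₃) := by
    unfold PDEvent Dtilde inU
    exact (hc a₁ a₂ hx1.symm hx2.symm).compl.inter
      (free_union (hc a₃ a₁ hx3.symm hx1.symm) (hc a₃ a₂ hx3.symm hx2.symm)).compl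
  have hT : Free f (TEvent ends a₁ a₂ a₃) := by
    unfold TEvent
    exact (hc a₂ a₁ hx2.symm hx1.symm).compl.inter (hc a₂ a₃ hx2.symm hx3.symm)
  have hT' : Free f (TEvent ends a₂ a₁ a₃) := by
    unfold TEvent
    exact (hc a₁ a₂ hx1.symm hx2.symm).compl.inter (hc a₁ a₃ hx1.symm hx3.symm)
  have key : ∀ A : Set (Config E), Free f A → prob (Function.update p f t) A = prob p A :=
    fun A hA => PendantEdm.prob_update_of_free p hA t
  simp only [HMFc, marginC, DEF, Do, EQo, EQ3, EQ3o, massM2, deltaT, gap]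
  rw [Xhat_update_leaf p hf hleaf hxy hxo hx1 hx2 hx3.symm hxb t]
  simp only [key _ hQ, key _ hPD, key _ hT, key _ hT',
    key _ (hPD.inter (hc a₁ o hx1.symm hxo.symm)), key _ (hPD.inter (hc a₂ o hx2.symm hxo.symm)),
    key _ (hPD.inter (hc a₂ b hx2.symm hxb.symm)),
    key _ ((hc a₂ b hx2.symm hxb.symm).inter hT), key _ ((hc a₁ b hx1.symm hxb.symm).inter hT),
    key _ (hQ.inter (hc a₁ o hx1.symm hxo.symm)), key _ (hQ.inter (hc a₂ o hx2.symm hxo.symm)),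
    key _ (hT'.inter (hc a₁ o hx1.symm hxo.symm)), key _ (hT'.inter (hc a₂ o hx2.symm hxo.symm)),
    key _ (hT.inter (hc a₁ o hx1.symm hxo.symm)), key _ (hT.inter (hc a₂ o hx2.symm hxo.symm)),
    key _ (hc a₂ b hx2.symm hxb.symm), key _ (hc a₁ b hx1.symm hxb.symm)]

end Main

end HMFLeafInvisible

end Summit.Ventures.PercRepro2
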